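import Summits.Ventures.PercRepro.Night2NonFatColoop
import Summits.Ventures.PercRepro.Night2NonFatStructure
import Summits.Ventures.PercRepro.Night2FatXUnloaded
import Summits.Ventures.PercRepro.Night2GoodTwoGoodTargets
import Summits.Ventures.PercRepro.Night2GoodTwoD2Axes

/-!
# night-2: the NON-FAT case of (FAIR) — the NESTED-LINE regime is closed (gen 37)

THE LINE-PLUS-TWO REGIME: all of `W = G ∖ Q` but two points `y₁, y₂` lies on a basis line `ℓ = cl (Q ∖ A)`, `A` three
points of the basis `Q ∖ K` (so `ℓ` is spanned by the other two basis points `a, b`).  Then both `y₁` and `y₂` are coloop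
points — `W ∖ {y₁} ⊆ ℓ ∪ {y₂}` has rank `≤ 3` — and the plane `cl (W ∖ {y₁})` contains `ℓ` (two dead points of `W` on `ℓ`
span it, `N ≥ 4`), hence the two basis points `a, b`: the coloop theorem `basis_pair_fair_of_two_coloops` applies with
`s ≤ 4` (**`basis_pair_fair_of_line_plus_two`**).  In terms of the faces: a lossy basis pair with EXACTLY THREE active faces
whose hole sets coincide in a two-point set `{y₁, y₂}` is in this regime (`dead_mem_clF_of_three`:
**`basis_pair_fair_of_three_faces_common_holes`**) — the nested-line family of the numerics (`W` = a long basis line plus two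
points; levels `≤ 2` criterion `1.8 – 3.3`, coloop sum exactly `3/2`).
Paper: proofs/NIGHT-2-g37.md §5.
-/

namespace PercRepro.Shadow

open PercRepro.ThmH PercRepro.PerFlat

variable {α : Type*} [DecidableEq α] {M : Matroid α} [M.Finite] {G : Finset α}

/-- A point of `V = G ∖ K` in the closure of `K ∪ X` lies in the closure of `X` (`K = {e₀}` the coloop). -/
theorem mem_clF_sdiff_coloops_of_mem_clF (hG : G ∈ flatsQ M (5 + 1)) (hk : kColoops M G = 1) {X : Finset α}
    (hXG : X ⊆ G) {y : α} (hy : y ∈ G \ coloops M G) (hcl : y ∈ clF M X) : y ∈ clF M (X \ coloops M G) := by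
  have hk1 : (coloops M G).card = 1 := by rw [← kColoops_eq_card_coloops]; exact hk
  obtain ⟨e₀, he₀⟩ := Finset.card_eq_one.1 hk1
  have he₀c : e₀ ∈ coloops M G := by rw [he₀]; exact Finset.mem_singleton_self _
  have hye : y ≠ e₀ := fun h => (Finset.mem_sdiff.1 hy).2 (h ▸ he₀c)
  rw [he₀, Finset.sdiff_singleton_eq_erase]
  exact mem_clF_erase_coloop_of_mem_clF hG he₀c hXG (Finset.mem_sdiff.1 hy).1 hye hcl

/-- **The line-plus-two regime**: `W ∖ {y₁, y₂} ⊆ cl (Q ∖ A)` with `|A| = 3`, `A ⊆ Q ∖ K`, gives the fair share. -/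
theorem basis_pair_fair_of_line_plus_two (hG : G ∈ flatsQ M (5 + 1)) (hd : (gr M \ G).card = 2)
    (hk : kColoops M G = 1) (hs : ∀ e ∈ gr M, ∀ f ∈ gr M, e ≠ f → rkN M {e, f} = 2)
    (hl : ∀ e ∈ gr M, M.Indep {e}) (hnf : fatClosures M 5 G 2 = ∅) {B : Finset α}
    (hB : B ∈ thinMembers M 5 G) (hnP : ¬ bigP M G B) {z : α} (hz : z ∈ G \ clF M B)
    (hl0 : loss M 5 G B z ≠ 0) {A : Finset α} (hA : A ⊆ insert z B \ coloops M G) (h3 : A.card = 3)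
    {y₁ y₂ : α} (hne : y₁ ≠ y₂) (hy₁ : y₁ ∈ G \ insert z B) (hy₂ : y₂ ∈ G \ insert z B)
    (hline : ∀ y ∈ G \ insert z B, y ≠ y₁ → y ≠ y₂ → y ∈ clF M (insert z B \ A)) :
    loss M 5 G B z ≤ rhoL M 5 G B z * lossIncomeH M 5 G (bigP M G) (dshGT2 M 5 G) B z := by
  have hd' : (gr M \ G).card ≤ 5 := by omega
  have hGg : G ⊆ gr M := (mem_flatsQ.1 hG).1
  have hBG : B ⊆ G := subset_G_of_mem_thinMembers hB
  have hQG : insert z B ⊆ G := Finset.insert_subset (Finset.mem_sdiff.1 hz).1 hBG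
  have hKB : coloops M G ⊆ B := coloops_subset_of_mem_thinMembers hG hd' hB
  have hKQ : coloops M G ⊆ insert z B := hKB.trans (Finset.subset_insert _ _)
  have h4 := card_sdiff_eq_four_of_not_bigP hG hd hk hB hnP
  have hzB : z ∉ B := fun h => (Finset.mem_sdiff.1 hz).2 (subset_clF_of_subset_gr (hBG.trans hGg) h)
  -- the two basis points off `A`: `L = (Q ∖ A) ∖ K`, a two-point set
  set L : Finset α := (insert z B \ A) \ coloops M G with hL
  have hLQ : L ⊆ insert z B \ coloops M G := Finset.sdiff_subset_sdiff Finset.sdiff_subset (le_refl _)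
  have hLcard : L.card = 2 := by
    have hQK : (insert z B \ coloops M G).card = 5 := by
      have h1 : insert z B \ coloops M G = insert z (B \ coloops M G) := by
        ext e
        simp only [Finset.mem_sdiff, Finset.mem_insert]
        constructor
        · rintro ⟨h | h, hK⟩
          · exact Or.inl h
          · exact Or.inr ⟨h, hK⟩
        · rintro (rfl | ⟨h, hK⟩)
          · exact ⟨Or.inl rfl, fun hK => hzB (hKB hK)⟩
          · exact ⟨Or.inr h, hK⟩
      rw [h1, Finset.card_insert_of_notMem (fun h => hzB (Finset.mem_sdiff.1 h).1), h4]
    have hdisjAK : Disjoint A (coloops M G) := by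
      rw [Finset.disjoint_left]
      intro e heA heK
      exact (Finset.mem_sdiff.1 (hA heA)).2 heK
    have heq : L = (insert z B \ coloops M G) \ A := by
      rw [hL]
      ext e
      simp only [Finset.mem_sdiff]
      tauto
    rw [heq, Finset.card_sdiff_of_subset hA, hQK, h3]
  have hLg : L ⊆ gr M := hLQ.trans (Finset.sdiff_subset.trans (hQG.trans hGg))
  have hrL : rkN M L ≤ 2 := by
    have := rkN_le_card (M := M) L
    omega
  -- the dead points lie in `cl L`
  have hdead : ∀ y ∈ G \ insert z B, y ≠ y₁ → y ≠ y₂ → y ∈ clF M L := by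
    intro y hy hy1 hy2
    have hyV : y ∈ G \ coloops M G :=
      Finset.mem_sdiff.2 ⟨(Finset.mem_sdiff.1 hy).1, fun hK => (Finset.mem_sdiff.1 hy).2 (hKQ hK)⟩
    exact mem_clF_sdiff_coloops_of_mem_clF hG hk (Finset.sdiff_subset.trans hQG) hyV (hline y hy hy1 hy2)
  -- `W ∖ {y_i}` has rank `≤ 3`
  have hrank : ∀ {u v : α}, u ≠ v → u ∈ G \ insert z B → v ∈ G \ insert z B →
      (∀ y ∈ G \ insert z B, y ≠ u → y ≠ v → y ∈ clF M L) → rkN M ((G \ insert z B).erase u) ≤ 3 := by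
    intro u v huv hu hv hdead'
    have hsub : (G \ insert z B).erase u ⊆ insert v (clF M L) := by
      intro y hy
      rw [Finset.mem_erase] at hy
      rw [Finset.mem_insert]
      by_cases hyv : y = v
      · exact Or.inl hyv
      · exact Or.inr (hdead' y hy.2 hy.1 hyv)
    have h1 := rkN_mono (M := M) hsub
    have h2 : rkN M (insert v (clF M L)) ≤ rkN M L + 1 := by
      have := rkN_union_le_add_card (M := M) (clF M L) {v}
      rw [Finset.card_singleton, rkN_clF] at this
      rw [Finset.insert_eq, Finset.union_comm]
      exact this
    omega
  have hr₁ : rkN M ((G \ insert z B).erase y₁) ≤ 3 := hrank hne hy₁ hy₂ hdead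
  have hr₂ : rkN M ((G \ insert z B).erase y₂) ≤ 3 :=
    hrank hne.symm hy₂ hy₁ (fun y hy h2 h1 => hdead y hy h1 h2)
  -- two dead points span `cl L`, so `L ⊆ cl (W ∖ {y_i})` and `|(T ∖ K) ∖ cl (W ∖ {y_i})| ≤ 4`
  have hN := four_le_card_sdiff_insert hG hd hB hz
  obtain ⟨d₁, hd₁, d₂, hd₂, hd₁₂⟩ : ∃ d₁ ∈ (G \ insert z B) \ {y₁, y₂}, ∃ d₂ ∈ (G \ insert z B) \ {y₁, y₂}, d₁ ≠ d₂ := by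
    have hsub : ({y₁, y₂} : Finset α) ⊆ G \ insert z B := by
      intro e he
      rw [Finset.mem_insert, Finset.mem_singleton] at he
      rcases he with rfl | rfl
      · exact hy₁
      · exact hy₂
    have hc := Finset.card_sdiff_of_subset hsub
    rw [Finset.card_pair hne] at hc
    exact Finset.one_lt_card.1 (by omega)
  have hdmem : ∀ d ∈ (G \ insert z B) \ {y₁, y₂}, d ∈ G \ insert z B ∧ d ≠ y₁ ∧ d ≠ y₂ := by
    intro d hd
    rw [Finset.mem_sdiff, Finset.mem_insert, Finset.mem_singleton, not_or] at hd
    exact ⟨hd.1, hd.2.1, hd.2.2⟩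
  have hclD : clF M {d₁, d₂} = clF M L := by
    apply clF_eq_clF_of_subset_clF_of_rkN_le hLg
    · intro e he
      rw [Finset.mem_insert, Finset.mem_singleton] at he
      rcases he with rfl | rfl
      · exact hdead _ (hdmem _ hd₁).1 (hdmem _ hd₁).2.1 (hdmem _ hd₁).2.2
      · exact hdead _ (hdmem _ hd₂).1 (hdmem _ hd₂).2.1 (hdmem _ hd₂).2.2
    · rw [hs d₁ (hGg (Finset.mem_sdiff.1 (hdmem _ hd₁).1).1) d₂ (hGg (Finset.mem_sdiff.1 (hdmem _ hd₂).1).1) hd₁₂]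
      exact hrL
  have hLcl : ∀ {u : α}, u ≠ d₁ → u ≠ d₂ → L ⊆ clF M ((G \ insert z B).erase u) := by
    intro u hu1 hu2
    have hsub : ({d₁, d₂} : Finset α) ⊆ (G \ insert z B).erase u := by
      intro e he
      rw [Finset.mem_insert, Finset.mem_singleton] at he
      rw [Finset.mem_erase]
      rcases he with rfl | rfl
      · exact ⟨fun h => hu1 h.symm, (hdmem _ hd₁).1⟩
      · exact ⟨fun h => hu2 h.symm, (hdmem _ hd₂).1⟩
    calc L ⊆ clF M L := subset_clF_of_subset_gr hLg
      _ = clF M {d₁, d₂} := hclD.symm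
      _ ⊆ clF M ((G \ insert z B).erase u) := clF_mono hsub
  have hcard : ∀ {u : α}, u ∈ G \ insert z B → u ≠ d₁ → u ≠ d₂ →
      ((insert u (insert z B) \ coloops M G) \ clF M ((G \ insert z B).erase u)).card ≤ 4 := by
    intro u hu hu1 hu2
    have h6 := card_insert_sdiff_coloops_eq_six hG hd hk hB hnP hz hu
    have hLT : L ⊆ insert u (insert z B) \ coloops M G :=
      hLQ.trans (Finset.sdiff_subset_sdiff (Finset.subset_insert _ _) (le_refl _))
    have hsub : (insert u (insert z B) \ coloops M G) \ clF M ((G \ insert z B).erase u) ⊆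
        (insert u (insert z B) \ coloops M G) \ L :=
      Finset.sdiff_subset_sdiff (le_refl _) (hLcl hu1 hu2)
    have := Finset.card_le_card hsub
    rw [Finset.card_sdiff_of_subset hLT, h6, hLcard] at this
    exact this
  exact basis_pair_fair_of_two_coloops hG hd hk hs hl hnf hB hnP hz hl0 hne hy₁ hy₂ hr₁ hr₂
    (hcard hy₁ (fun h => (hdmem _ hd₁).2.1 h.symm) (fun h => (hdmem _ hd₂).2.1 h.symm))
    (hcard hy₂ (fun h => (hdmem _ hd₁).2.2 h.symm) (fun h => (hdmem _ hd₂).2.2 h.symm))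

/-- **Three active faces with a common two-point hole set settle the pair**: every other point of `W` lies in the closures of
all three faces, hence on the basis line `cl (Q ∖ A)` (`dead_mem_clF_of_three`), and the line-plus-two regime applies. -/
theorem basis_pair_fair_of_three_faces_common_holes (hG : G ∈ flatsQ M (5 + 1)) (hd : (gr M \ G).card = 2)
    (hk : kColoops M G = 1) (hs : ∀ e ∈ gr M, ∀ f ∈ gr M, e ≠ f → rkN M {e, f} = 2)
    (hl : ∀ e ∈ gr M, M.Indep {e}) (hnf : fatClosures M 5 G 2 = ∅) {B : Finset α}
    (hB : B ∈ thinMembers M 5 G) (hnP : ¬ bigP M G B) {z : α} (hz : z ∈ G \ clF M B)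
    (hl0 : loss M 5 G B z ≠ 0) {A : Finset α} (hA : A ⊆ insert z B \ coloops M G) (h3 : A.card = 3)
    {y₁ y₂ : α} (hne : y₁ ≠ y₂) (hy₁ : y₁ ∈ G \ insert z B) (hy₂ : y₂ ∈ G \ insert z B)
    (hholes : ∀ w ∈ A, (G \ insert z B) \ clF M ((insert z B).erase w) = {y₁, y₂}) :
    loss M 5 G B z ≤ rhoL M 5 G B z * lossIncomeH M 5 G (bigP M G) (dshGT2 M 5 G) B z := by
  apply basis_pair_fair_of_line_plus_two hG hd hk hs hl hnf hB hnP hz hl0 hA h3 hne hy₁ hy₂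
  intro y hy hy1 hy2
  apply dead_mem_clF_of_three hG hd hk hB hnP hz (hA.trans Finset.sdiff_subset) (Finset.mem_sdiff.1 hy).1
  intro w hw
  by_contra hcl
  have : y ∈ (G \ insert z B) \ clF M ((insert z B).erase w) := Finset.mem_sdiff.2 ⟨hy, hcl⟩
  rw [hholes w hw, Finset.mem_insert, Finset.mem_singleton] at this
  rcases this with h | h
  · exact hy1 h
  · exact hy2 h

end PercRepro.Shadow
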